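import Mathlib.LinearAlgebra.Dual.Lemmas
import Mathlib.LinearAlgebra.FiniteDimensional.Lemmas
import Mathlib.Data.Real.Basic
import HarnessLib

/-!
# NE7InvariantFunctionalLetter — PALAIS' PRINCIPLE OF SYMMETRIC CRITICALITY IN FINITE DIMENSION, AS TWO LINEAR-ALGEBRA LETTERS:
# (A1) an INVARIANT linear functional that vanishes on the FIXED vectors of a family of isometries vanishes identically;
# (A2) an EQUIVARIANT surjection is surjective FROM fixed vectors ONTO fixed vectors

Cell `pub-balaban`, rung (B)+1 sub-cell t4, lineage `b2b-balaban-t4-ne7b-p1` (row NE7b OWNER + CRUX PROVER; junction service for row NE7, ruling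
R-OWNER-149-1 (2)), generation 158.  Junction census of ROAD-G114 §8's STABILISER DESIGN ISSUE («whenever Stab(V₀) moves U♯ … no single-valued C¹
section over data exists»; the genericity hypothesis of `NE7MinimalActionDifferentiable.minAct_hasFDerivAt_generic`): the census reading is that the
minimal orbit NEVER breaks the datum's residual symmetry, by symmetric criticality.  THIS FILE is the abstract half.

THE ARGUMENT.  `W` a finite-dimensional real vector space with a positive-definite bilinear form `B` (no symmetry needed), `𝒯` any set of
`B`-isometries (hence injective, hence bijective), `ℓ` a `𝒯`-invariant functional vanishing on `{w | ∀ T ∈ 𝒯, T w = w}`.  Riesz (`B : W → W⋆` is injective,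
so onto by the dimension count `dim W⋆ = dim W`) gives `ℓ = B w₀`.  For `T ∈ 𝒯`: `B (T w₀ − w₀) (T v) = ℓ v − ℓ (T v) = 0` for every `v`, and `T` is onto, so
`T w₀ = w₀`; hence `ℓ w₀ = 0 = B w₀ w₀`, `w₀ = 0`, `ℓ = 0` (A1).  For (A2) (`T : E → G` onto, `T ∘ S_i = R_i ∘ T`, `S_i`, `R_i` isometries of positive forms):
the image `U := T(E^S)` of the fixed subspace lies in the fixed subspace `G^R`; if `g ∈ G^R` is `B_G`-orthogonal to `U`, the functional `v ↦ B_G g (T v)` on `E`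
is `S`-invariant and vanishes on `E^S`, so it is `0` by (A1), whence `B_G g g = 0` (`T` onto) and `g = 0`; therefore `g ↦ B_G g|_U : G^R → U⋆` is injective,
`dim G^R ≤ dim U`, and `U = G^R`.
WHAT ([folklore]; 0 def, 0 sorry).  `exists_riesz_of_posDef`, `injective_of_isometry`, **`eq_zero_of_invariant_of_vanish_on_fixed`** (A1),
**`exists_fixed_preimage_of_equivariant`** (A2).
HONEST FRAMING (page 1): finite-dimensional linear algebra over Mathlib; nothing of Bałaban's; NOT NE7, NOT NE3, row NE7b NOT PRINTED ∕ NOT PROVED;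
spine 0∕9; finite T⁴ rung (B)+1 — NOT infinite volume, NOT mass gap, NOT BetaPertH, NOT Clay (continuum YM on T⁴ ⇐ BetaPertH ∧ nine spine estimates).
-/

set_option autoImplicit false

open Module

namespace Summit.QuantumFields.BalabanUV.T4Continuum.NE7InvariantFunctionalLetter

variable {W : Type*} [AddCommGroup W] [Module ℝ W] [FiniteDimensional ℝ W]

/-- **RIESZ FOR A POSITIVE-DEFINITE BILINEAR FORM** on a finite-dimensional real space: every functional is `B w₀`. [folklore] -/
theorem exists_riesz_of_posDef (B : W →ₗ[ℝ] W →ₗ[ℝ] ℝ) (hpos : ∀ v : W, v ≠ 0 → 0 < B v v) (ℓ : W →ₗ[ℝ] ℝ) :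
    ∃ w₀ : W, ∀ v : W, ℓ v = B w₀ v := by
  have hinj : Function.Injective B := by
    intro v w h
    by_contra hne
    have h1 : B (v - w) (v - w) = 0 := by
      have h2 : B (v - w) = 0 := by rw [map_sub, h, sub_self]
      rw [h2, LinearMap.zero_apply]
    exact (hpos (v - w) (sub_ne_zero.mpr hne)).ne' h1
  have hsurj : Function.Surjective B :=
    (LinearMap.injective_iff_surjective_of_finrank_eq_finrank (Subspace.dual_finrank_eq).symm).mp hinj
  obtain ⟨w₀, hw₀⟩ := hsurj ℓ
  exact ⟨w₀, fun v => by rw [← hw₀]⟩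

/-- An isometry of a positive-definite form is injective, hence (finite dimension) surjective. [folklore] -/
theorem injective_of_isometry (B : W →ₗ[ℝ] W →ₗ[ℝ] ℝ) (hpos : ∀ v : W, v ≠ 0 → 0 < B v v) {T : W →ₗ[ℝ] W}
    (hiso : ∀ v w : W, B (T v) (T w) = B v w) : Function.Injective T ∧ Function.Surjective T := by
  have hinj : Function.Injective T := by
    intro v w h
    by_contra hne
    have h1 : B (v - w) (v - w) = 0 := by
      have h2 : T (v - w) = 0 := by rw [map_sub, h, sub_self]
      rw [← hiso, h2, map_zero]
    exact (hpos (v - w) (sub_ne_zero.mpr hne)).ne' h1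
  exact ⟨hinj, LinearMap.injective_iff_surjective.mp hinj⟩

/-- **(A1) AN INVARIANT FUNCTIONAL THAT VANISHES ON THE FIXED VECTORS VANISHES** (Palais' symmetric criticality, linear-algebra core): `B` positive
definite on the finite-dimensional real space `W`, `𝒯` a set of `B`-isometries, `ℓ ∘ T = ℓ` for `T ∈ 𝒯`, and `ℓ w = 0` whenever `T w = w` for all
`T ∈ 𝒯` ⟹ `ℓ = 0`. [folklore] -/
theorem eq_zero_of_invariant_of_vanish_on_fixed (B : W →ₗ[ℝ] W →ₗ[ℝ] ℝ) (hpos : ∀ v : W, v ≠ 0 → 0 < B v v)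
    (𝒯 : Set (W →ₗ[ℝ] W)) (hiso : ∀ T ∈ 𝒯, ∀ v w : W, B (T v) (T w) = B v w)
    (ℓ : W →ₗ[ℝ] ℝ) (hinv : ∀ T ∈ 𝒯, ∀ v : W, ℓ (T v) = ℓ v) (hfix : ∀ w : W, (∀ T ∈ 𝒯, T w = w) → ℓ w = 0) :
    ℓ = 0 := by
  obtain ⟨w₀, hw₀⟩ := exists_riesz_of_posDef B hpos ℓ
  have hTfix : ∀ T ∈ 𝒯, T w₀ = w₀ := by
    intro T hT
    obtain ⟨-, hTsurj⟩ := injective_of_isometry B hpos (hiso T hT)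
    have key : ∀ v : W, B (T w₀ - w₀) (T v) = 0 := fun v => by
      rw [map_sub, LinearMap.sub_apply, hiso T hT, ← hw₀, ← hw₀, hinv T hT, sub_self]
    have h0 : B (T w₀ - w₀) (T w₀ - w₀) = 0 := by
      obtain ⟨v, hv⟩ := hTsurj (T w₀ - w₀)
      have h := key v
      rwa [hv] at h
    by_contra hne
    exact (hpos _ (sub_ne_zero.mpr hne)).ne' h0
  have hℓw : ℓ w₀ = 0 := hfix w₀ hTfix
  have hw0 : w₀ = 0 := by
    by_contra hne
    have h := hpos w₀ hne
    rw [← hw₀, hℓw] at h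
    exact lt_irrefl _ h
  ext v
  rw [hw₀, hw0, map_zero]

/-- (A1) read pointwise. [folklore] -/
theorem apply_eq_zero_of_invariant_of_vanish_on_fixed (B : W →ₗ[ℝ] W →ₗ[ℝ] ℝ) (hpos : ∀ v : W, v ≠ 0 → 0 < B v v)
    (𝒯 : Set (W →ₗ[ℝ] W)) (hiso : ∀ T ∈ 𝒯, ∀ v w : W, B (T v) (T w) = B v w)
    (ℓ : W →ₗ[ℝ] ℝ) (hinv : ∀ T ∈ 𝒯, ∀ v : W, ℓ (T v) = ℓ v) (hfix : ∀ w : W, (∀ T ∈ 𝒯, T w = w) → ℓ w = 0) (v : W) :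
    ℓ v = 0 := by
  rw [eq_zero_of_invariant_of_vanish_on_fixed B hpos 𝒯 hiso ℓ hinv hfix, LinearMap.zero_apply]

/-! ## (A2) Equivariant surjections are surjective on the fixed vectors -/

section Equivariant

variable {E G : Type*} [AddCommGroup E] [Module ℝ E] [FiniteDimensional ℝ E] [AddCommGroup G] [Module ℝ G] [FiniteDimensional ℝ G]

omit [FiniteDimensional ℝ E] in
/-- The fixed subspace of a family of linear maps. [folklore] -/
theorem mem_fixedSub_iff {ι : Type*} (S : ι → E →ₗ[ℝ] E) (v : E) :
    v ∈ (⨅ i, LinearMap.ker (S i - LinearMap.id) : Submodule ℝ E) ↔ ∀ i, S i v = v := by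
  simp only [Submodule.mem_iInf, LinearMap.mem_ker, LinearMap.sub_apply, LinearMap.id_apply, sub_eq_zero]

/-- **(A2) AN EQUIVARIANT SURJECTION IS ONTO FROM FIXED VECTORS TO FIXED VECTORS**: `T : E → G` linear onto, `T ∘ S_i = R_i ∘ T` with `S_i` (resp. `R_i`)
isometries of positive-definite forms `B_E` (resp. `B_G`) on the finite-dimensional real spaces `E`, `G`; then every `γ` with `R_i γ = γ` for all `i` is
`T Φ` for some `Φ` with `S_i Φ = Φ` for all `i`. [folklore] -/
theorem exists_fixed_preimage_of_equivariant {ι : Type*} (BE : E →ₗ[ℝ] E →ₗ[ℝ] ℝ) (hE : ∀ v : E, v ≠ 0 → 0 < BE v v)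
    (BG : G →ₗ[ℝ] G →ₗ[ℝ] ℝ) (hG : ∀ g : G, g ≠ 0 → 0 < BG g g)
    (S : ι → E →ₗ[ℝ] E) (R : ι → G →ₗ[ℝ] G) (hS : ∀ i, ∀ v w : E, BE (S i v) (S i w) = BE v w)
    (hR : ∀ i, ∀ v w : G, BG (R i v) (R i w) = BG v w)
    (T : E →ₗ[ℝ] G) (hT : Function.Surjective T) (hequiv : ∀ i, ∀ v : E, T (S i v) = R i (T v))
    (γ : G) (hγ : ∀ i, R i γ = γ) : ∃ Φ : E, (∀ i, S i Φ = Φ) ∧ T Φ = γ := by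
  classical
  -- the fixed subspaces and the image of the fixed subspace
  set E₀ : Submodule ℝ E := ⨅ i, LinearMap.ker (S i - LinearMap.id) with hE₀
  set G₀ : Submodule ℝ G := ⨅ i, LinearMap.ker (R i - LinearMap.id) with hG₀
  set U : Submodule ℝ G := E₀.map T with hU
  have hUle : U ≤ G₀ := by
    rintro g ⟨v, hv, rfl⟩
    rw [SetLike.mem_coe, mem_fixedSub_iff] at hv
    rw [mem_fixedSub_iff]
    intro i
    rw [← hequiv i, hv i]
  -- a vector of `G₀` orthogonal to `U` vanishes (A1)
  have hperp : ∀ g ∈ G₀, (∀ u ∈ U, BG g u = 0) → g = 0 := by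
    intro g hg hgU
    rw [mem_fixedSub_iff] at hg
    have hℓ : (BG g).comp T = 0 := by
      refine eq_zero_of_invariant_of_vanish_on_fixed BE hE (Set.range S) ?_ ((BG g).comp T) ?_ ?_
      · rintro _ ⟨i, rfl⟩ v w
        exact hS i v w
      · rintro _ ⟨i, rfl⟩ v
        rw [LinearMap.comp_apply, LinearMap.comp_apply, hequiv i]
        calc BG g (R i (T v)) = BG (R i g) (R i (T v)) := by rw [hg i]
          _ = BG g (T v) := hR i g (T v)
      · intro w hw
        rw [LinearMap.comp_apply]
        refine hgU (T w) ⟨w, ?_, rfl⟩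
        rw [SetLike.mem_coe, mem_fixedSub_iff]
        intro i
        exact hw (S i) ⟨i, rfl⟩
    have h0 : BG g g = 0 := by
      obtain ⟨v, hv⟩ := hT g
      have h := LinearMap.congr_fun hℓ v
      rw [LinearMap.comp_apply, hv, LinearMap.zero_apply] at h
      exact h
    by_contra hne
    exact (hG g hne).ne' h0
  -- `g ↦ B_G g|_U : G₀ → U⋆` is injective, so `dim G₀ ≤ dim U⋆ = dim U`, and `U = G₀`
  set f : ↥G₀ →ₗ[ℝ] Module.Dual ℝ ↥U := (U.subtype.dualMap).comp (BG.domRestrict G₀) with hf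
  have hfinj : Function.Injective f := by
    intro g₁ g₂ h
    have hsub : f (g₁ - g₂) = 0 := by rw [map_sub, h, sub_self]
    have hz : ((g₁ - g₂ : ↥G₀) : G) = 0 := by
      refine hperp _ (g₁ - g₂).2 fun u hu => ?_
      have h1 := LinearMap.congr_fun hsub ⟨u, hu⟩
      simpa [hf] using h1
    exact sub_eq_zero.mp (by exact_mod_cast hz)
  have hdim : finrank ℝ ↥G₀ ≤ finrank ℝ ↥U := by
    have h1 := LinearMap.finrank_le_finrank_of_injective hfinj
    rwa [Subspace.dual_finrank_eq] at h1
  have hUG : U = G₀ := Submodule.eq_of_le_of_finrank_le hUle hdim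
  have hγ₀ : γ ∈ G₀ := by rw [mem_fixedSub_iff]; exact hγ
  rw [← hUG] at hγ₀
  obtain ⟨Φ, hΦ, hTΦ⟩ := hγ₀
  rw [SetLike.mem_coe, mem_fixedSub_iff] at hΦ
  exact ⟨Φ, hΦ, hTΦ⟩

end Equivariant

end Summit.QuantumFields.BalabanUV.T4Continuum.NE7InvariantFunctionalLetter
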